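/- Width seat `ym-line-cbag-p1-w2` (prover-ym-line-cbag-p1-w2-g14-0) on the planner-of-record's LINE 6, route `SmallBetaInfraredSplit` (sub QCD):
helper for the β = 0 stubs `stub_irZero` (crux `IRBoundSmallBeta`, stmt-QuantumFields-27240) and `stub_floorZero` (crux `NeighbourFloorSmallBeta`,
stmt-QuantumFields-27241).  β = 0 dictionary only; RECORD-rung material (LADDER-YM Q1, QCD side); nothing about a mass gap, the continuum or any
summit is proved here. -/
import Literature.MathematicalPhysics.QuantumLattice.StrongCouplingDeterminantRepresentation
import Literature.MathematicalPhysics.StatisticalMechanics.ComplexSpinInfraredBoundProof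
import HarnessLib

/-!
# Route `SmallBetaInfraredSplit`: the `β = 0` dictionary between the determinant representation and the complex spin system

Both crux skeletons of the line (`IRBoundSmallBeta`, `NeighbourFloorSmallBeta`) state the gauge two-point function in the DETERMINANT /
PROPAGATOR form of the leaf `SalmhoferSeilerSmallBeta`:
`G_β(x,y) = (∫ Re det D₀[U] · Re W_{xy}(D₀[U]⁻¹) d(wilsonWeight ρ β)) / (∫ Re det D₀[U] d(wilsonWeight ρ β))`,
`W_{xy}(G) = (tr G_{xx})(tr G_{yy}) − tr(G_{xy}G_{yx})`.  At `β = 0` the tree identifies this with the Berezin/Haar expectation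
`Re⟨ψ̄ψ(x)ψ̄ψ(y)⟩` (`StrongCoupling.detRep_twoPoint_eq_fermiExpect_re`) and, by Salmhofer–Seiler (2.21) (`StrongCoupling.fermiExpect_spinObs`),
with `(2N)²` times the complex-spin two-point function `⟨σ_xσ_y⟩_Λ` of the `U(N)` bond data:

* `detRep_eq_sq_mul_expect` — `G_0(x,y) = (2N)² · ComplexSpin.expect N 0 (uNBondCoeff N) (σ_x σ_y)` (even `L ≥ 2`, `N ≥ 1`);
* `expect_field_mul_field` — bilinearity `⟨σ(u)σ(v)⟩_Λ = Σ_{x,y} u_x ⟨σ_xσ_y⟩_Λ v_y` at the level of `expect` (the tree has it for `bracket`).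

[SalmhoferSeiler1991, §2 (2.10)–(2.12), (2.21), Remark 4.10(1)]; [folklore] bookkeeping.  No rung or summit statement is proved here.
-/

set_option autoImplicit false

noncomputable section

namespace Summit.QuantumFields.QCD.Theorems.SmallBetaInfraredSplit

open MeasureTheory
open Literature.Probability.LatticeModels (TorusSite)
open Literature.MathematicalPhysics.QuantumFieldTheory
open Literature.MathematicalPhysics.QuantumLattice
open Literature.MathematicalPhysics.QuantumLattice.StrongCoupling
open Literature.MathematicalPhysics.QuantumLattice.StaggeredSingular (D0)
open Literature.MathematicalPhysics.StatisticalMechanics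

/-- **`β = 0` dictionary (Salmhofer–Seiler Remark 4.10(1): `⟨ψ̄ψ(x)ψ̄ψ(y)⟩ = (2N)²⟨σ_xσ_y⟩`) in the determinant representation**: for
`N ≥ 1`, `ν ≥ 1` and an even torus of side `L ≥ 2`,
`(∫ Re det D₀ · Re W_{xy}(D₀⁻¹) d(wilsonWeight ρ 0)) / (∫ Re det D₀ d(wilsonWeight ρ 0)) = (2N)² · ⟨σ_x σ_y⟩_Λ`
with `⟨·⟩_Λ = ComplexSpin.expect N 0 (uNBondCoeff N)`. [cite: SalmhoferSeiler1991, Remark 4.10(1) with (2.21)] -/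
theorem detRep_eq_sq_mul_expect {ν L N : ℕ} [NeZero L] (hN1 : 1 ≤ N) (hν : 1 ≤ ν) (hE : Even L) (hL1 : 1 < L)
    (x y : TorusSite ν L) :
    (∫ U, ((D0 U).det).re * (wick2 (D0 U)⁻¹ x y).re
        ∂(wilsonWeight (d := ν) (L := L) (unitaryFundamentalRep (Fin N) ℂ) 0)) /
      (∫ U, ((D0 U).det).re ∂(wilsonWeight (d := ν) (L := L) (unitaryFundamentalRep (Fin N) ℂ) 0)) =
    (2 * N : ℝ) ^ 2 * ComplexSpin.expect N 0 (ComplexSpin.uNBondCoeff N) (MvPolynomial.X x * MvPolynomial.X y) := by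
  classical
  haveI : NeZero ν := ⟨by omega⟩
  -- an arbitrary linear order of the sites (the statement does not depend on it)
  letI : LinearOrder (TorusSite ν L) :=
    LinearOrder.lift' (Fintype.equivFin (TorusSite ν L)) (Fintype.equivFin (TorusSite ν L)).injective
  have h2Nr : (2 * N : ℝ) ≠ 0 := by exact_mod_cast (by omega : 2 * N ≠ 0)
  have hΓ : ∀ b : TorusSite ν L × Fin ν, (stagSigns ν L) b ^ 2 = 1 := fun p => staggeredPhase_sq p.1 p.2
  -- the scaled two-meson expectation is the complex-spin two-point function, (2.21)
  have hspin : (fermiExpect (torusLinks ν L) (stagSigns ν L) ((0 : ℝ) : ℂ)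
      (fun _ => (((2 * N : ℂ)⁻¹ • meson x) * ((2 * N : ℂ)⁻¹ • meson y) : FermiAlg (TorusSite ν L) N))).re =
      ComplexSpin.expect N 0 (ComplexSpin.uNBondCoeff N) (MvPolynomial.X x * MvPolynomial.X y) := by
    rw [← spinObs_X_mul_X, fermiExpect_spinObs hL1 _ hΓ, Complex.ofReal_re]
  -- and it is `(2N)⁻²` times the determinant representation
  have hterm : (fermiExpect (torusLinks ν L) (stagSigns ν L) ((0 : ℝ) : ℂ)
      (fun _ => (((2 * N : ℂ)⁻¹ • meson x) * ((2 * N : ℂ)⁻¹ • meson y) : FermiAlg (TorusSite ν L) N))).re =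
      ((2 * N : ℝ)⁻¹ * (2 * N : ℝ)⁻¹) *
        ((∫ U, ((D0 U).det).re * (wick2 (D0 U)⁻¹ x y).re
            ∂(wilsonWeight (d := ν) (L := L) (unitaryFundamentalRep (Fin N) ℂ) 0)) /
          (∫ U, ((D0 U).det).re ∂(wilsonWeight (d := ν) (L := L) (unitaryFundamentalRep (Fin N) ℂ) 0))) := by
    rw [detRep_twoPoint_eq_fermiExpect_re hE hL1, smul_meson_mul_smul_meson, fermiExpect, fermiExpect,
      fermiBracket_const_smul _ (torusLinks_ne hL1), mul_div_assoc,
      show ((2 * N : ℂ)⁻¹ * (2 * N : ℂ)⁻¹) = (((2 * N : ℝ)⁻¹ * (2 * N : ℝ)⁻¹ : ℝ) : ℂ) by push_cast; ring,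
      Complex.re_ofReal_mul]
  have key := hterm.symm.trans hspin
  have hc : (2 * N : ℝ) ^ 2 * ((2 * N : ℝ)⁻¹ * (2 * N : ℝ)⁻¹) = 1 := by
    rw [sq, mul_mul_mul_comm, mul_inv_cancel₀ h2Nr, one_mul]
  rw [← key, ← mul_assoc, hc, one_mul]

/-- **Bilinearity of the complex-spin expectation in the smeared fields**: `⟨σ(u)σ(v)⟩_Λ = Σ_{x,y} u_x ⟨σ_xσ_y⟩_Λ v_y`
(the tree's `ComplexSpin.bracket_field_mul_field` divided by `Z_Λ`). [cite: SalmhoferSeiler1991, (3.77) and (3.100)] -/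
theorem expect_field_mul_field {ν L : ℕ} [NeZero L] (N : ℕ) (m : ℝ) (a : ℕ → ℝ) (u v : TorusSite ν L → ℝ) :
    ComplexSpin.expect N m a (ComplexSpin.field u * ComplexSpin.field v) =
      ∑ x : TorusSite ν L, ∑ y : TorusSite ν L,
        u x * ComplexSpin.expect N m a (MvPolynomial.X x * MvPolynomial.X y) * v y := by
  simp only [ComplexSpin.expect_eq_div]
  rw [ComplexSpin.bracket_field_mul_field, Finset.sum_div]
  refine Finset.sum_congr rfl fun x _ => ?_
  rw [Finset.sum_div]
  refine Finset.sum_congr rfl fun y _ => ?_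
  ring

end Summit.QuantumFields.QCD.Theorems.SmallBetaInfraredSplit

end
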